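import Summits.ResolutionOfSingularities.ResolutionOfSingularities.Theorems.MarkedTransferCampaignW24ReducedRunUniversal
import HarnessLib

/-!
# The R47 (B) carriers SW and SB in the reduced model: the `γ_*`-run EXHAUSTS IN THE BOX AT EVERY DEPTH (all `ℓ ≥ 2`), by proof
# (HIRONAKA-L, §9 kernel support for the OURS target L-47B-s1 «bottom-member re-run», slot W2.4; res-adj-2 2026-08-27T06:15:17Z
# (c3) «name SB as the worked instance»; upgrades K24-REPORT F1/F4 from `ℓ ∈ {3,4,5}` by engine to every `ℓ` by kernel)

**HONEST FRAMING.** OURS throughout (see `MarkedTransferCampaignW24ReducedRun.lean`): the carriers are the REDUCED one-variable forms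
(PREREG-K24 §B7) of the R47 (B) countermodel series `ε_SW = Σ_{k≥0} ω₁^{2k}ω₂³` (p489606 `Lem95CoupledCountermodel.SW`) and
`ε_SB = Σ_{k≥1} ω₁^{2k}ω₂³` (p491132 `Lem95CoupledBox.SB`): `G₀^{SW} = Σ_m t^m = 1/(1+t)`, `G₀^{SB} = Σ_{m≥1} t^m = t/(1+t)`
(`t = ω₁²`, `p = 2`, `q = 2`). Nothing below is a statement of [Hironaka2017] (lit key `paper:url-3343fd9e678b`), nothing asserts that
any statement of it holds, nothing is a claim about resolution of singularities in characteristic `p`; the manuscript stays «under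
review» (D-0012/D-0089). AI work, weaker than expert review.

## What is proved (characteristic `2`; `K` a field for the run statements)
* `E N = Σ_l t^{Nl}` (`(1 − t^N)·E N = 1`, `E N·E N = E(2N)`); carrier family `tau F i = t^{2^i−1}·F·E(2^i)`, `order_tau`.
* `D_tau_sub_X_pow`, `univStepI_tau`, `univStep_tau`, `univRun_tau_one`: for `F(0) = 1` and `F` with no nonzero coefficient at a
  positive even exponent, `univStep (τ_i F) = τ_{i+1} F` (`i ≥ 1`) — the bottom digit goes `2^i − 1 ↦ 2^{i+1} − 1`.
* `canonRun_tau_exhausts`, `sb_exhausts_all_depths`, `sw_exhausts_all_depths`: for EVERY `L ≥ 1` (`ℓ = L+1`, `P = 2^L`) the canonical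
  reduced run of SB has digits `2^{j+1} − 1 < P` (`j < L`) and `G_L = 0`; that of SW (Case (III) first step `G₁ ≡ τ_1(swB)`, any legal
  `w`, `sw_legal_inverse`) has digits `0, 1, 3, …, 2^L − 1` and `G_{L+1} = 0` — K24-REPORT F1/F4 for every depth.
Hypotheses: each theorem's own binders; no FACT-LIST fact, no DEFECT binder. Written by res-D-pv-035 AS res-L1-k24. Standard axioms.
-/

noncomputable section

set_option linter.dupNamespace false -- mandated namespace of this single-conjunct summit

namespace Summit.ResolutionOfSingularities.ResolutionOfSingularities.Theorems

namespace CampaignW24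

namespace ReducedRun

open PowerSeries
open Literature.RingTheory.MvPowerSeries (hasseDeriv coeff_hasseDeriv IsSupportedOnMultiples)

universe u

variable {A : Type u} [CommRing A]

/-! ## Worked instances at `p = 2` for ALL depths: the R47 (B) carriers SW and SB (PREREG-K24 §B1, §E; res-adj-2
2026-08-27T06:15:17Z (c3) «name SB as the worked instance») -/

section Carriers

/-- [OURS · L W2.4 reduced model] `E N = Σ_{l ≥ 0} t^{N l}` — the inverse of `1 − t^N` (in characteristic `2`: of `1 + t^N`). OURS bookkeeping.
[folklore] -/
def E (N : ℕ) : A⟦X⟧ := mk fun m => if N ∣ m then 1 else 0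

/-- Coefficients of `E N`. [folklore] -/
theorem coeff_E (N m : ℕ) : coeff m (E N : A⟦X⟧) = if N ∣ m then 1 else 0 := coeff_mk _ _

/-- `E N` has constant term `1`. [folklore] -/
theorem constantCoeff_E (N : ℕ) : constantCoeff (E N : A⟦X⟧) = 1 := by
  rw [← coeff_zero_eq_constantCoeff_apply, coeff_E, if_pos (dvd_zero N)]

/-- `(1 − t^N)·E N = 1` for `0 < N`. [folklore] -/
theorem one_sub_X_pow_mul_E {N : ℕ} (hN : 0 < N) : (1 - X ^ N) * (E N : A⟦X⟧) = 1 := by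
  ext m
  rw [sub_mul, one_mul, map_sub, coeff_X_pow_mul', coeff_E, coeff_one]
  by_cases hm0 : m = 0
  · subst hm0
    rw [if_pos (dvd_zero N), if_neg (by omega), if_pos rfl, sub_zero]
  · rw [if_neg hm0]
    by_cases hNm : N ≤ m
    · rw [if_pos hNm, coeff_E]
      by_cases hd : N ∣ m
      · obtain ⟨c, hc⟩ := hd
        have hd' : N ∣ m - N := ⟨c - 1, by rw [hc, Nat.mul_sub, mul_one]⟩
        rw [if_pos ⟨c, hc⟩, if_pos hd', sub_self]
      · have hd' : ¬ N ∣ m - N := fun h => hd (by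
          have := dvd_add h (dvd_refl N); rwa [Nat.sub_add_cancel hNm] at this)
        rw [if_neg hd, if_neg hd', sub_zero]
    · rw [if_neg hNm, if_neg (fun h => hm0 (Nat.eq_zero_of_dvd_of_lt h (by omega))), sub_zero]

/-- `1 − t^N` is a series in `t^N`. [folklore] -/
theorem isSupportedOnMultiples_one_sub_X_pow (N : ℕ) :
    IsSupportedOnMultiples N ((1 - X ^ N : A⟦X⟧) : MvPowerSeries Unit A) := by
  intro m ⟨i, hi⟩
  have h1 : (MvPowerSeries.coeff m : MvPowerSeries Unit A →ₗ[A] A) = coeff (m ()) :=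
    (PowerSeries.coeff_def (s := m) rfl).symm
  rw [h1]
  cases i
  have h0 : m () ≠ 0 := fun h => hi (by rw [h]; exact dvd_zero N)
  have hN' : m () ≠ N := fun h => hi (by rw [h])
  show coeff (m ()) (1 - X ^ N : A⟦X⟧) = 0
  rw [map_sub, coeff_one, coeff_X_pow, if_neg h0, if_neg hN', sub_zero]

/-- [OURS · L W2.4 reduced model] The **carrier family** `τ_i(F) = t^{2^i − 1}·F·E(2^i)` (`= t^{2^i−1}·F/(1 − t^{2^i})`). For `F = 1 + t` these
are the states of the universal run of SB, for `F = swB` those of SW (from state `1`). OURS bookkeeping. [folklore] -/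
def tau (F : A⟦X⟧) (i : ℕ) : A⟦X⟧ := X ^ (2 ^ i - 1) * (F * E (2 ^ i))

/-- The bottom coefficient of `τ_i(F)` is `F(0)`. [folklore] -/
theorem coeff_tau_self (F : A⟦X⟧) (i : ℕ) : coeff (2 ^ i - 1) (tau F i) = constantCoeff F := by
  unfold tau
  rw [coeff_X_pow_mul', if_pos le_rfl, Nat.sub_self, coeff_zero_eq_constantCoeff_apply, map_mul,
    constantCoeff_E, mul_one]

/-- `ord τ_i(F) = 2^i − 1` when `F(0) = 1`. [folklore] -/
theorem order_tau [Nontrivial A] {F : A⟦X⟧} (hF0 : constantCoeff F = 1) (i : ℕ) :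
    order (tau F i) = (2 ^ i - 1 : ℕ) := by
  rw [order_eq_nat, coeff_tau_self, hF0]
  refine ⟨one_ne_zero, fun m hm => ?_⟩
  unfold tau
  rw [coeff_X_pow_mul', if_neg (by omega)]

section Two

variable [CharP A 2]

/-- In characteristic `2`, `−f = f` on `A⟦t⟧`. [folklore] -/
theorem neg_eq_self_charTwo (f : A⟦X⟧) : -f = f := by
  ext m; rw [map_neg, CharTwo.neg_eq]

/-- In characteristic `2`, `E N · E N = E(2N)` (`0 < N`): `1/(1+t^N)² = 1/(1+t^{2N})`. [folklore] -/
theorem E_mul_E {N : ℕ} (hN : 0 < N) : (E N : A⟦X⟧) * E N = E (2 * N) := by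
  have hfac : (1 - X ^ (2 * N) : A⟦X⟧) = (1 - X ^ N) * (1 - X ^ N) := by
    have h1 : (1 - X ^ (2 * N) : A⟦X⟧) = (1 - X ^ N) * (1 + X ^ N) := by ring
    rw [h1, ← neg_eq_self_charTwo (X ^ N : A⟦X⟧), ← sub_eq_add_neg, neg_eq_self_charTwo]
  have hE : (E N * E N : A⟦X⟧) * (1 - X ^ (2 * N)) = 1 := by
    rw [hfac]
    calc (E N * E N : A⟦X⟧) * ((1 - X ^ N) * (1 - X ^ N))
        = ((1 - X ^ N) * E N) * ((1 - X ^ N) * E N) := by ring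
      _ = 1 := by rw [one_sub_X_pow_mul_E hN, one_mul]
  exact left_inv_eq_right_inv hE (one_sub_X_pow_mul_E (by omega))

/-- `C(m, 2^i − 1)` in characteristic `2`: `= 1` if `m ≡ −1 (mod 2^i)`, `= 0` otherwise (`choose_pow_sub_one_modEq`).
[cite: Abad2019pBases, Lemma 6.2 (Lucas arithmetic; kernel bookkeeping)] -/
theorem natCast_choose_two_pow_sub_one (i m : ℕ) :
    ((m.choose (2 ^ i - 1) : ℕ) : A) = if m % 2 ^ i = 2 ^ i - 1 then 1 else 0 := by
  have h := CharP.natCast_eq_natCast' A 2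
    (Literature.RingTheory.MvPowerSeries.choose_pow_sub_one_modEq 2 i m)
  rw [h]; split_ifs <;> simp

/-- **The universal step on the carrier family (derivative factor).** For `i ≥ 1`, `F(0) = 1` and `F` with no
nonzero coefficient at a positive EVEN exponent: `D^{(2^i − 1)}(τ_i(F) − t^{2^i−1}) = t^{2^i}·E(2^i)`. Lucas kills the
odd exponents of `F − 1` (binomial `C(n + 2^i − 1, 2^i − 1) ≡ [2^i ∣ n]`), and the self-term `t^{2^{i+1} − 1}` of
`(1 − t^{2^i})·τ_i` contributes `t^{2^i}`. [folklore] -/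
theorem D_tau_sub_X_pow {F : A⟦X⟧} (hF0 : constantCoeff F = 1)
    (hF : ∀ j, 0 < j → 2 ∣ j → coeff j F = 0) {i : ℕ} (hi : 1 ≤ i) :
    D (2 ^ i - 1) (tau F i - X ^ (2 ^ i - 1)) = X ^ (2 ^ i) * E (2 ^ i) := by
  have hN : 0 < 2 ^ i := pow_pos two_pos i
  have hKN : 2 ^ i - 1 < 2 ^ i := Nat.sub_lt hN one_pos
  have h2i : 2 ∣ 2 ^ i := dvd_pow_self 2 (by omega)
  -- linearity of `D^{(K)}` over series in `t^{2^i}`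
  have hlin : D (2 ^ i - 1) ((1 - X ^ (2 ^ i)) * (tau F i - X ^ (2 ^ i - 1))) =
      (1 - X ^ (2 ^ i)) * D (2 ^ i - 1) (tau F i - X ^ (2 ^ i - 1)) :=
    D_mul_of_isSupportedOnMultiples 2 (L := i) hKN (isSupportedOnMultiples_one_sub_X_pow _) _
  -- the product
  have hprod : (1 - X ^ (2 ^ i)) * (tau F i - X ^ (2 ^ i - 1)) =
      X ^ (2 ^ i - 1) * (F - 1) + X ^ (2 ^ i - 1 + 2 ^ i) := by
    calc (1 - X ^ (2 ^ i)) * (tau F i - X ^ (2 ^ i - 1))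
        = X ^ (2 ^ i - 1) * F * ((1 - X ^ (2 ^ i)) * E (2 ^ i)) - (1 - X ^ (2 ^ i)) * X ^ (2 ^ i - 1) := by
          unfold tau; ring
      _ = X ^ (2 ^ i - 1) * (F - 1) + X ^ (2 ^ i - 1 + 2 ^ i) := by rw [one_sub_X_pow_mul_E hN]; ring
  -- `D^{(K)}` kills `t^K (F − 1)`
  have hD1 : D (2 ^ i - 1) (X ^ (2 ^ i - 1) * (F - 1)) = 0 := by
    ext n
    rw [coeff_D, coeff_X_pow_mul', if_pos (Nat.le_add_left _ _), Nat.add_sub_cancel, map_zero, map_sub,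
      coeff_one]
    by_cases hn0 : n = 0
    · subst hn0; rw [if_pos rfl, coeff_zero_eq_constantCoeff_apply, hF0, sub_self, mul_zero]
    · rw [if_neg hn0, sub_zero]
      by_cases hn2 : 2 ∣ n
      · rw [hF n (Nat.pos_of_ne_zero hn0) hn2, mul_zero]
      · rw [natCast_choose_two_pow_sub_one, if_neg, zero_mul]
        intro hmod
        apply hn2
        have hdvd : 2 ^ i ∣ n := by
          have := Nat.dvd_sub_mod (n := 2 ^ i) (n + (2 ^ i - 1))
          rwa [hmod, Nat.add_sub_cancel] at this
        exact h2i.trans hdvd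
  -- `D^{(K)} t^{K+N} = t^N`
  have hD2 : D (2 ^ i - 1) (X ^ (2 ^ i - 1 + 2 ^ i) : A⟦X⟧) = X ^ (2 ^ i) := by
    rw [D_X_pow, if_pos (Nat.le_add_right _ _), Nat.add_sub_cancel_left, natCast_choose_two_pow_sub_one,
      if_pos, one_smul]
    rw [Nat.add_mod_right, Nat.mod_eq_of_lt hKN]
  -- assemble: multiply `(1 − t^N)·D(...) = t^N` by `E N`
  calc D (2 ^ i - 1) (tau F i - X ^ (2 ^ i - 1))
      = E (2 ^ i) * ((1 - X ^ (2 ^ i)) * D (2 ^ i - 1) (tau F i - X ^ (2 ^ i - 1))) := by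
        rw [← mul_assoc, mul_comm (E _), one_sub_X_pow_mul_E hN, one_mul]
    _ = X ^ (2 ^ i) * E (2 ^ i) := by rw [← hlin, hprod, map_add, hD1, hD2, zero_add, mul_comm]

/-- **The universal step on the carrier family.** For `i ≥ 1` and `F` as above:
`univStepI 1 (2^i − 1) (τ_i(F)) = τ_{i+1}(F)` — the bottom digit DOUBLES-PLUS-ONE (`2^i − 1 ↦ 2^{i+1} − 1`). [folklore] -/
theorem univStepI_tau {F : A⟦X⟧} (hF0 : constantCoeff F = 1) (hF : ∀ j, 0 < j → 2 ∣ j → coeff j F = 0)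
    {i : ℕ} (hi : 1 ≤ i) : univStepI 1 (2 ^ i - 1) (tau F i) = tau F (i + 1) := by
  have hN : 0 < 2 ^ i := pow_pos two_pos i
  unfold univStepI
  rw [coeff_tau_self, hF0, map_one, one_mul, one_mul, D_tau_sub_X_pow hF0 hF hi, neg_eq_self_charTwo]
  have hexp : 2 ^ (i + 1) - 1 = 2 ^ i - 1 + 2 ^ i := by rw [pow_succ]; omega
  unfold tau
  rw [hexp, pow_add, pow_succ, mul_comm (2 ^ i) 2, ← E_mul_E hN]
  ring

end Two

section TwoField

variable {K : Type u} [Field K] [CharP K 2]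

/-- Over a field of characteristic `2`: `univStep (τ_i(F)) = τ_{i+1}(F)` for `i ≥ 1`. [folklore] -/
theorem univStep_tau {F : K⟦X⟧} (hF0 : constantCoeff F = 1) (hF : ∀ j, 0 < j → 2 ∣ j → coeff j F = 0)
    {i : ℕ} (hi : 1 ≤ i) : univStep (tau F i) = tau F (i + 1) := by
  unfold univStep
  rw [order_tau hF0, ENat.toNat_coe, coeff_tau_self, hF0, inv_one]
  exact univStepI_tau hF0 hF hi

/-- The universal run from `τ_1(F)`: `γ_j = τ_{j+1}(F)`, bottom digits `k_j = 2^{j+1} − 1`. [folklore] -/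
theorem univRun_tau_one {F : K⟦X⟧} (hF0 : constantCoeff F = 1) (hF : ∀ j, 0 < j → 2 ∣ j → coeff j F = 0) :
    ∀ j : ℕ, univRun (tau F 1) j = tau F (j + 1)
  | 0 => rfl
  | j + 1 => by
    show univStep (univRun (tau F 1) j) = _
    rw [univRun_tau_one hF0 hF j, univStep_tau hF0 hF (Nat.succ_pos j)]

/-- **ALL-DEPTH EXHAUSTION for the carrier family.** If `G₁ ≡ τ_1(F) (mod t^{2^L})` (`L ≥ 1`), the canonical
depth-`2^L` Case-(I) run from `G₁` has bottom digits `2^{j+1} − 1` for `j < L` (all inside the box) and is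
EXHAUSTED at state `L`: `G_{1+L} = 0`. OURS (reduced model). [folklore] -/
theorem canonRun_tau_exhausts {F : K⟦X⟧} (hF0 : constantCoeff F = 1)
    (hF : ∀ j, 0 < j → 2 ∣ j → coeff j F = 0) {L : ℕ} (hL : 1 ≤ L) {G₁ : K⟦X⟧}
    (h1 : EqBelow (2 ^ L) G₁ (tau F 1)) :
    canonRun (2 ^ L) G₁ L = 0 ∧
      ∀ j < L, order (canonRun (2 ^ L) G₁ j) = (2 ^ (j + 1) - 1 : ℕ) ∧ 2 ^ (j + 1) - 1 < 2 ^ L := by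
  have hbox : ∀ i ≤ L, ∀ j < i, ∃ k : ℕ, order (univRun (tau F 1) j) = k ∧ k < 2 ^ L := by
    intro i hi j hj
    refine ⟨2 ^ (j + 1) - 1, by rw [univRun_tau_one hF0 hF j, order_tau hF0], ?_⟩
    have : 2 ^ (j + 1) ≤ 2 ^ L := Nat.pow_le_pow_right two_pos (by omega)
    have : 0 < 2 ^ (j + 1) := pow_pos two_pos _
    omega
  obtain ⟨L', rfl⟩ : ∃ L', L = L' + 1 := ⟨L - 1, by omega⟩
  refine ⟨canonRun_succ_eq_zero_of_univDigit 2 h1 L' (hbox L' (Nat.le_succ L')) ?_, fun j hj => ?_⟩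
  · rw [univRun_tau_one hF0 hF L', order_tau hF0]
  · have hlt : 2 ^ (j + 1) - 1 < 2 ^ (L' + 1) := by
      have : 2 ^ (j + 1) ≤ 2 ^ (L' + 1) := Nat.pow_le_pow_right two_pos (by omega)
      have : 0 < 2 ^ (j + 1) := pow_pos two_pos _
      omega
    exact ⟨order_canonRun_eq 2 h1 j (hbox j (le_of_lt hj))
      (by rw [univRun_tau_one hF0 hF j, order_tau hF0]) hlt, hlt⟩

/-! ### SB: `ε_SB = Σ_{k ≥ 1} ω₁^{2k} ω₂³` (p491132 `Lem95CoupledBox.SB`), reduced `G₀ = t/(1 + t) = τ_1(1 + t)` -/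

/-- [OURS · L W2.4 reduced model] The reduced SB carrier `G₀^{SB} = Σ_{m ≥ 1} t^m = t/(1 + t)` (`t = ω₁²`; PREREG-K24 §B7, K24-REPORT §4). OURS.
[folklore] -/
def sbCarrier : K⟦X⟧ := mk fun m => if m = 0 then 0 else 1

omit [CharP K 2] in
/-- `G₀^{SB} = τ_1(1 + t)` (`t(1+t)/(1 − t²) = t/(1 − t)`; no characteristic hypothesis). [folklore] -/
theorem sbCarrier_eq_tau : (sbCarrier : K⟦X⟧) = tau (1 + X) 1 := by
  have h : (1 - X ^ 2) * (sbCarrier : K⟦X⟧) = X ^ (2 ^ 1 - 1) * (1 + X) := by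
    ext m
    rw [sub_mul, one_mul, map_sub, coeff_X_pow_mul', pow_one, pow_one, mul_add, mul_one, map_add,
      ← pow_two, coeff_X_pow, coeff_X]
    unfold sbCarrier
    rw [coeff_mk]
    by_cases h2 : 2 ≤ m
    · rw [if_pos h2, coeff_mk, if_neg (by omega)]
      by_cases hm2 : m = 2
      · subst hm2; simp
      · rw [if_neg (by omega), if_neg (by omega), if_neg hm2, sub_self, add_zero]
    · rw [if_neg h2, sub_zero]
      by_cases hm0 : m = 0
      · subst hm0; simp
      · rw [if_neg hm0, if_pos (by omega), if_neg (by omega), add_zero]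
  calc (sbCarrier : K⟦X⟧) = E 2 * ((1 - X ^ 2) * sbCarrier) := by
        rw [← mul_assoc, mul_comm (E 2), one_sub_X_pow_mul_E two_pos, one_mul]
    _ = tau (1 + X) 1 := by rw [h]; unfold tau; rw [pow_one]; ring

/-- **SB, ALL DEPTHS.** For every `L ≥ 1` the canonical reduced `γ_*`-run of SB at depth `ℓ = L + 1` (`P = 2^L`) has
bottom digits `k_*(j) = 2^{j+1} − 1` (`j < L`), all inside the Frobenius box, and is EXHAUSTED at state `L = ℓ − 1`:
`G_L = 0`. This is K24-REPORT §4 (SB: `k_* = 1, 3, 7, 15`, exhaustion at `i = ℓ − 1`) for EVERY depth, by proof.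
OURS (reduced model; res-adj-2 2026-08-27T06:15:17Z «name SB as the worked instance»). [folklore] -/
theorem sb_exhausts_all_depths {L : ℕ} (hL : 1 ≤ L) :
    canonRun (2 ^ L) (sbCarrier : K⟦X⟧) L = 0 ∧
      ∀ j < L, order (canonRun (2 ^ L) (sbCarrier : K⟦X⟧) j) = (2 ^ (j + 1) - 1 : ℕ) ∧
        2 ^ (j + 1) - 1 < 2 ^ L :=
  canonRun_tau_exhausts (F := 1 + X) (by rw [map_add, map_one, constantCoeff_X, add_zero])
    (fun j hj _ => by
      rw [map_add, coeff_one, coeff_X, if_neg (by omega), if_neg (by omega), add_zero])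
    hL (by rw [sbCarrier_eq_tau]; exact EqBelow.refl _)

/-! ### SW: `ε_SW = Σ_{k ≥ 0} ω₁^{2k} ω₂³` (p489606 `Lem95CoupledCountermodel.SW`), reduced `G₀ = 1/(1 + t)`;
Case (III) at state `0` (`k_* = 0`, `M = 2^{q+1} = 8`), then `γ_1 = G₀ − G₀^8 = τ_1(B)` -/

/-- [OURS · L W2.4 reduced model] The reduced SW carrier `G₀^{SW} = Σ_{m ≥ 0} t^m = 1/(1 + t) = E 1` (`t = ω₁²`; PREREG-K24 §B7/§E). OURS. [folklore] -/
def swCarrier : K⟦X⟧ := E 1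

/-- [OURS · L W2.4 reduced model] The SW cofactor `B = (1 + t^7)/(1 + t)^7 = 1 + Σ_{j ≥ 0}(t^{8j+1} + t^{8j+7})`. OURS bookkeeping. [folklore] -/
def swB : K⟦X⟧ := mk fun m => if m = 0 ∨ m % 8 = 1 ∨ m % 8 = 7 then 1 else 0

omit [CharP K 2] in
/-- `ord G₀^{SW} = 0`: state `0` of SW is in Case (III) (`k_* = 0`). [folklore] -/
theorem order_swCarrier : order (swCarrier : K⟦X⟧) = 0 := by
  rw [← Nat.cast_zero, order_eq_nat]
  exact ⟨by unfold swCarrier; rw [coeff_E, if_pos (dvd_zero 1)]; exact one_ne_zero,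
    fun i hi => absurd hi (Nat.not_lt_zero i)⟩

omit [CharP K 2] in
/-- The class-`0` unit of `G₀^{SW}` at depth `P` is `E P` (so its canonical inverse is `1 − t^P`). [folklore] -/
theorem unitPart_zero_swCarrier (P : ℕ) : unitPart P 0 (swCarrier : K⟦X⟧) = E P := by
  ext m
  unfold swCarrier
  rw [coeff_unitPart, coeff_E, add_zero, coeff_E, if_pos (one_dvd m)]

/-- `(G₀^{SW})^8 = E 8` in characteristic `2` (Frobenius: `(Σ t^m)^8 = Σ t^{8m}`). [folklore] -/
theorem swCarrier_pow_eight : (swCarrier : K⟦X⟧) ^ 8 = E 8 := by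
  unfold swCarrier
  have h2 : (E 1 : K⟦X⟧) ^ 2 = E 2 := by
    rw [pow_two, E_mul_E one_pos, mul_one]
  have h4 : (E 1 : K⟦X⟧) ^ 4 = E 4 := by
    rw [show (4 : ℕ) = 2 * 2 from rfl, pow_mul, h2, pow_two, E_mul_E two_pos]
  rw [show (8 : ℕ) = 4 * 2 from rfl, pow_mul, h4, pow_two, E_mul_E (by norm_num)]

/-- **SW, universal state 1.** `γ_1 = G₀ − G₀^8 = E 1 − E 8 = τ_1(B)` — i.e. `Σ_{8 ∤ m} t^m = t·B/(1 − t²)`.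
[folklore] -/
theorem swCarrier_sub_pow_eight : (swCarrier : K⟦X⟧) - swCarrier ^ 8 = tau swB 1 := by
  rw [swCarrier_pow_eight]
  unfold swCarrier
  have h : (1 - X ^ 2) * (E 1 - E 8 : K⟦X⟧) = X * swB := by
    have hE1 : (1 - X ^ 2) * (E 1 : K⟦X⟧) = 1 + X := by
      have : (1 - X ^ 2 : K⟦X⟧) = (1 + X) * (1 - X ^ 1) := by ring
      rw [this, mul_assoc, one_sub_X_pow_mul_E one_pos, mul_one]
    rw [mul_sub, hE1]
    ext m
    rw [map_sub, map_add, coeff_one, coeff_X, sub_mul, one_mul, map_sub, coeff_X_pow_mul', coeff_E,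
      coeff_E, ← pow_one (X : K⟦X⟧), coeff_X_pow_mul']
    unfold swB
    by_cases hm0 : m = 0
    · subst hm0
      rw [if_pos rfl, if_neg zero_ne_one, if_pos (dvd_zero 8), if_neg (by omega), if_neg (by omega)]
      ring
    rw [if_neg hm0]
    by_cases hm1 : m = 1
    · subst hm1
      rw [if_pos rfl, if_neg (by decide), if_neg (by omega), if_pos le_rfl, Nat.sub_self, coeff_mk,
        if_pos (Or.inl rfl)]
      ring
    rw [if_neg hm1, zero_add, if_pos (show 2 ≤ m by omega), if_pos (show 1 ≤ m by omega), coeff_mk]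
    simp only [Nat.dvd_iff_mod_eq_zero, zero_sub]
    have h1' : ¬ (m - 1 = 0) := by omega
    by_cases ha : m % 8 = 0
    · rw [if_pos ha, if_neg (by omega), if_pos (Or.inr (Or.inr (by omega))), sub_zero, CharTwo.neg_eq]
    · rw [if_neg ha]
      by_cases hb : m % 8 = 2
      · rw [if_pos (show (m - 2) % 8 = 0 by omega), if_pos (Or.inr (Or.inl (by omega))), zero_sub, neg_neg]
      · rw [if_neg (show ¬ (m - 2) % 8 = 0 by omega), if_neg (by omega), sub_zero, neg_zero]
  calc (E 1 - E 8 : K⟦X⟧) = E 2 * ((1 - X ^ 2) * (E 1 - E 8)) := by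
        rw [← mul_assoc, mul_comm (E 2), one_sub_X_pow_mul_E two_pos, one_mul]
    _ = tau swB 1 := by rw [h]; unfold tau; rw [pow_one, show 2 - 1 = 1 from rfl, pow_one]; ring

/-- **SW, state 1 at depth `P`.** For ANY legal inverse `w` of the class-`0` unit (`w·E P = 1`), the reduced
Case-(III) first step `G₁ = G₀ − w^7·G₀^8` agrees with `γ_1 = τ_1(B)` modulo `t^P`. [folklore] -/
theorem eqBelow_stepIII_swCarrier {P : ℕ} {w : K⟦X⟧} (hw : w * unitPart P 0 (swCarrier : K⟦X⟧) = 1) :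
    EqBelow P (stepIII w 8 swCarrier) (tau swB 1) := by
  have h := eqBelow_stepIII_univStepIII (M := 8) hw (EqBelow.refl swCarrier)
  have hc : constantCoeff w = 1 := by
    have h1 := congr_arg constantCoeff hw
    rwa [map_mul, unitPart_zero_swCarrier, constantCoeff_E, mul_one, map_one] at h1
  rw [hc] at h
  unfold univStepIII at h
  rwa [one_pow, map_one, one_mul, swCarrier_sub_pow_eight] at h

/-- **SW, ALL DEPTHS.** For every `L ≥ 1` (depth `ℓ = L + 1`, `P = 2^L`) and every legal first (Case-(III)) step
`G₁ = G₀ − w^7 G₀^8` (`w·u_* = 1`), the canonical reduced `γ_*`-run of SW has bottom digits `k_*(1 + j) = 2^{j+1} − 1`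
(`j < L`), all inside the Frobenius box, and is EXHAUSTED at state `L + 1 = ℓ`: `G_{L+1} = 0`. This is K24-REPORT F1
(`k_* = 0, 1, 3, 7, 15, …`, exhaustion at state `L + 1`) for EVERY depth, by proof rather than by engine. OURS
(reduced model of PREREG-K24 §B7). [folklore] -/
theorem sw_exhausts_all_depths {L : ℕ} (hL : 1 ≤ L) {w : K⟦X⟧}
    (hw : w * unitPart (2 ^ L) 0 (swCarrier : K⟦X⟧) = 1) :
    canonRun (2 ^ L) (stepIII w 8 (swCarrier : K⟦X⟧)) L = 0 ∧
      ∀ j < L, order (canonRun (2 ^ L) (stepIII w 8 (swCarrier : K⟦X⟧)) j) = (2 ^ (j + 1) - 1 : ℕ) ∧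
        2 ^ (j + 1) - 1 < 2 ^ L :=
  canonRun_tau_exhausts (F := swB)
    (by unfold swB; rw [constantCoeff_mk, if_pos (Or.inl rfl)])
    (fun j hj h2 => by
      unfold swB
      rw [coeff_mk, if_neg]
      rintro (h | h | h) <;> omega)
    hL (eqBelow_stepIII_swCarrier hw)

omit [CharP K 2] in
/-- The canonical Case-(III) inverse for SW exists at every depth: `(1 − t^P)·E P = 1`, so the hypothesis of
`sw_exhausts_all_depths` is met by `w = 1 − t^{2^L}`. [folklore] -/
theorem sw_legal_inverse (L : ℕ) : (1 - X ^ (2 ^ L)) * unitPart (2 ^ L) 0 (swCarrier : K⟦X⟧) = 1 := by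
  rw [unitPart_zero_swCarrier, one_sub_X_pow_mul_E (pow_pos two_pos L)]

end TwoField

end Carriers

end ReducedRun

end CampaignW24

end Summit.ResolutionOfSingularities.ResolutionOfSingularities.Theorems

end
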